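import Literature.Analysis.FluidPDE.LocalTypeI
import Literature.Analysis.FluidPDE.TypeIAncientLiouville
import HarnessLib

/-!
# The printed Type I bound `𝐈 < ∞`, constants and the Liouville conjecture (Albritton–Barker 2019)

Topic `Literature/Analysis/FluidPDE`; companion of `LocalTypeI.lean` (the printed notions of
Albritton–Barker 2019: `cknAEss` = `A` with `esssup_t`, `typeIBound ω` = `𝐈(ω)`, and the two
bullets of Thm 1.1, `LocalTypeISingularityExists` and `NontrivialMildAncientTypeIExists`) and of
`TypeIAncientLiouville.lean` (the same remarks for the accepted quantities `cknSum`, `sup_t` in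
`A`, i.e. for `NontrivialTypeIAncientExists` of `PartialRegularity.lean`).

D. Albritton, T. Barker, *On local Type I singularities of the Navier–Stokes equations and
Liouville theorems*, J. Math. Fluid Mech. 21 (2019), Paper No. 43 = arXiv:1811.00502, §1, prove
Theorem 1.1 — "The following are equivalent: • There exists a suitable weak solution with Type I
singular point. • There exists a non-trivial mild bounded ancient solution with `𝐈 < ∞`" — and
remark (same page, arXiv p. 3): "Together, `v ≡ const.` and `𝐈 < ∞` imply `v ≡ 0`"; about the
Liouville conjecture (L) of Koch–Nadirashvili–Seregin–Šverák 2009 ("mild bounded ancient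
solutions are constant"): "If true, the conjecture excludes Type I singularities"; and "In
principle, constructing ancient solutions with Type I decay is a (difficult) route to obtaining
Navier–Stokes singularities."

## Status of `NontrivialMildAncientTypeIExists` (why there is no `_holds`)

`Literature.Analysis.FluidPDE.NontrivialMildAncientTypeIExists` is the *second bullet* of
Theorem 1.1, an **open** existence statement: the paper asserts only its equivalence with the
first bullet (existence of a suitable weak solution with a Type I singular point, itself open —
"many questions concerning feasible Type I scenarios … remain completely open", A–B §1), never
the bullet; a witness would be a Type I blow-up profile of the three-dimensional Navier–Stokes
equations, and (L) predicts there is none. It is therefore a registered open statement in the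
sense of CONVENTIONS §4, not literature debt, exactly like its twin `NontrivialTypeIAncientExists`.
This file proves (sorry-free) what the printed remark gives for the **printed** quantities:

* `ae_slice_eq_zero_of_abTypeIBound`: if `𝐈 = typeIBound (ℝ₋ × ℝ³) u p G < ∞` and the slice
  `u t` is a.e. equal to a constant for a.e. `t < 0`, then `u t = 0` a.e. for a.e. `t < 0`
  (the ball `Q((0, 0), r)` contributes `esssup_{-r² < t < 0} r⁻¹ ∫_{B_r} |u(t)|² ≤ 𝐈`, and an
  a.e.-constant slice `b` gives `r² |B₁| |b|²`, unbounded in `r` unless `b = 0`; with `esssup_t`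
  only almost every slice is seen, hence the a.e.-in-time form); repackaged unconditionally as
  `not_ae_slice_const_of_abTypeIBound`: a field jointly a.e.-strongly measurable on the slab,
  not a.e. zero there and with `𝐈 < ∞` is not slice-wise a.e. constant;
* `LiouvilleConjectureNS.ae_eq_zero_slab_of_abTypeIBound`: under (L), a bounded ancient mild
  solution (`ν = 1`) with a.e.-strongly measurable slices, jointly a.e.-strongly measurable on
  the slab `(-∞, 0) × ℝ³`, with `𝐈 < ∞`, is a.e. zero on the slab;
* `LiouvilleConjectureNS.exists_not_aestronglyMeasurable_slice_of_abTypeIBound` and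
  `LiouvilleConjectureNS.not_nontrivialMildAncientTypeIExists_measurable`: under (L), every
  witness `(u, p, G)` of `NontrivialMildAncientTypeIExists` has a slice `u t`, `t < 0`, that is
  not a.e.-strongly measurable; equivalently (L) refutes the variant of
  `NontrivialMildAncientTypeIExists` with measurable slices;
* `not_liouvilleConjectureNS_of_nontrivialMildAncientTypeI_measurable`: the sanity link — that
  variant is literally `NontrivialMildAncientTypeIExists` plus one measurability clause, and a
  witness of it gives `NontrivialMildAncientTypeIExists ∧ ¬ LiouvilleConjectureNS`.

NOT proved here (all open): `NontrivialMildAncientTypeIExists`, its negation, (L), and the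
unconditional `LiouvilleConjectureNS → ¬ NontrivialMildAncientTypeIExists` — the accepted
duality-form class `FluidPDE.IsBoundedAncientMildSolution` carries no per-slice measurability,
(L) as vendored (`LiouvilleConjectureNS`) asks for `AEStronglyMeasurable (u t)` at every `t < 0`,
and the other clauses of `NontrivialMildAncientTypeIExists` give joint local integrability only
(measurable slices for a.e. `t`); the same gap as in `TypeIAncientLiouville.lean` and
`KNSSLiouvilleBridge.lean`. No definitions, no named facts.

## References

* D. Albritton, T. Barker, J. Math. Fluid Mech. 21 (2019), no. 43 = arXiv:1811.00502, §1:
  Thm 1.1, the displays defining `A`, `C`, `D`, `E`, `𝐈(ω)` and the three sentences quoted above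
  (arXiv p. 3). [AlbrittonBarker2019]
* G. Koch, N. Nadirashvili, G. Seregin, V. Šverák, Acta Math. 203 (2009) 83–105, §1
  (conjecture (L)). [KochNadirashviliSereginSverak2009]
-/

noncomputable section

open MeasureTheory Set Function Filter Metric
open scoped ENNReal NNReal Topology

namespace Literature.Analysis.FluidPDE

section LocalTypeILiouville

variable {u : ℝ → EuclideanSpace ℝ (Fin 3) → EuclideanSpace ℝ (Fin 3)}
  {p : ℝ → EuclideanSpace ℝ (Fin 3) → ℝ}
  {G : ℝ → EuclideanSpace ℝ (Fin 3) → EuclideanSpace ℝ (Fin 3) →L[ℝ] EuclideanSpace ℝ (Fin 3)}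

/-- The parabolic balls `Q((0, 0), r) = (-r², 0) × B_r(0)` centred at the space–time origin lie
in the half-space `ℝ³ × ℝ₋ = (-∞, 0) × ℝ³`, so they are admissible in `𝐈 = 𝐈(ℝ³ × ℝ₋)`.
[folklore] -/
theorem parabolicCylinder_origin_subset_slab (r : ℝ) :
    FluidPDE.parabolicCylinder r ((0 : ℝ), (0 : EuclideanSpace ℝ (Fin 3))) ⊆
      Iio (0 : ℝ) ×ˢ (univ : Set (EuclideanSpace ℝ (Fin 3))) := by
  intro w hw
  rw [FluidPDE.mem_parabolicCylinder] at hw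
  exact ⟨hw.1.2, mem_univ _⟩

/-- `A(Q((0, 0), r)) ≤ 𝐈(ℝ³ × ℝ₋)` for `r > 0`: one admissible ball, one of the four summands
(Albritton–Barker 2019, §1, the displays defining `A` and `𝐈(ω)`).
[cite: AlbrittonBarker2019, §1 after Thm 1.1] -/
theorem cknAEss_origin_le_typeIBound {r : ℝ} (hr : 0 < r) :
    cknAEss r ((0 : ℝ), (0 : EuclideanSpace ℝ (Fin 3))) u ≤
      typeIBound (Iio (0 : ℝ) ×ˢ (univ : Set (EuclideanSpace ℝ (Fin 3)))) u p G :=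
  calc cknAEss r ((0 : ℝ), (0 : EuclideanSpace ℝ (Fin 3))) u
      ≤ abScaledSum r ((0 : ℝ), (0 : EuclideanSpace ℝ (Fin 3))) u p G :=
        le_add_right (le_add_right le_self_add)
    _ ≤ typeIBound (Iio (0 : ℝ) ×ˢ (univ : Set (EuclideanSpace ℝ (Fin 3)))) u p G :=
        abScaledSum_le_typeIBound hr (parabolicCylinder_origin_subset_slab r)

/-- **Almost every slice is controlled by `𝐈`.** For `r > 0` and a.e. `t ∈ (-r², 0)`,
`r⁻¹ ∫_{B_r(0)} |u(t)|² ≤ A(Q((0, 0), r)) ≤ 𝐈(ℝ³ × ℝ₋)` — the `esssup_t` in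
Albritton–Barker's `A` sees almost every time slice (Mathlib `ENNReal.ae_le_essSup`).
[cite: AlbrittonBarker2019, §1 after Thm 1.1] -/
theorem ae_energy_ball_le_typeIBound {r : ℝ} (hr : 0 < r) :
    ∀ᵐ t ∂(volume.restrict (Ioo (-r ^ 2) (0 : ℝ))),
      (ENNReal.ofReal r)⁻¹ * ∫⁻ x in ball (0 : EuclideanSpace ℝ (Fin 3)) r, ‖u t x‖ₑ ^ 2 ≤
        typeIBound (Iio (0 : ℝ) ×ˢ (univ : Set (EuclideanSpace ℝ (Fin 3)))) u p G := by
  have hA : essSup (fun t : ℝ =>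
        (ENNReal.ofReal r)⁻¹ * ∫⁻ x in ball (0 : EuclideanSpace ℝ (Fin 3)) r, ‖u t x‖ₑ ^ 2)
      (volume.restrict (Ioo (-r ^ 2) (0 : ℝ))) ≤
      typeIBound (Iio (0 : ℝ) ×ˢ (univ : Set (EuclideanSpace ℝ (Fin 3)))) u p G := by
    have h := cknAEss_origin_le_typeIBound (u := u) (p := p) (G := G) hr
    simpa only [cknAEss, zero_sub] using h
  filter_upwards [ENNReal.ae_le_essSup (μ := volume.restrict (Ioo (-r ^ 2) (0 : ℝ)))
    (fun t : ℝ =>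
      (ENNReal.ofReal r)⁻¹ * ∫⁻ x in ball (0 : EuclideanSpace ℝ (Fin 3)) r, ‖u t x‖ₑ ^ 2)]
    with t ht
  exact ht.trans hA

/-- **Constants are excluded by the printed Type I bound**, a.e.-in-time form (Albritton–Barker
2019, §1, the sentence after the definition of `𝐈(ω)`: "Together, `v ≡ const.` and `𝐈 < ∞`
imply `v ≡ 0`"): if `𝐈(ℝ³ × ℝ₋) = typeIBound (Iio 0 ×ˢ univ) u p G < ∞` and for a.e. `t < 0`
the slice `u t` is a.e. equal to some constant, then `u t = 0` a.e. for a.e. `t < 0`. Proof: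
at a time `t` where all the bounds of `ae_energy_ball_le_typeIBound` with integer radii hold
and `u t = b` a.e., every radius `n + 1 > -t` gives `(n+1)² |B₁| ‖b‖² ≤ 𝐈`, so `b = 0`.
(With `esssup_t` in `A` a single exceptional slice is invisible, whence "a.e. `t`".)
[cite: AlbrittonBarker2019, §1 after Thm 1.1] -/
theorem ae_slice_eq_zero_of_abTypeIBound
    (hI : typeIBound (Iio (0 : ℝ) ×ˢ (univ : Set (EuclideanSpace ℝ (Fin 3)))) u p G < ∞)
    (hconst : ∀ᵐ t ∂(volume.restrict (Iio (0 : ℝ))),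
      ∃ b : EuclideanSpace ℝ (Fin 3), u t =ᵐ[volume] fun _ => b) :
    ∀ᵐ t ∂(volume.restrict (Iio (0 : ℝ))), u t =ᵐ[volume] 0 := by
  set I : ℝ≥0∞ := typeIBound (Iio (0 : ℝ) ×ˢ (univ : Set (EuclideanSpace ℝ (Fin 3)))) u p G
    with hIdef
  -- all the integer-radius slice bounds hold at a.e. `t < 0`
  have hall : ∀ᵐ t ∂(volume.restrict (Iio (0 : ℝ))), ∀ n : ℕ,
      t ∈ Ioo (-((n : ℝ) + 1) ^ 2) (0 : ℝ) →
        (ENNReal.ofReal ((n : ℝ) + 1))⁻¹ *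
            ∫⁻ x in ball (0 : EuclideanSpace ℝ (Fin 3)) ((n : ℝ) + 1), ‖u t x‖ₑ ^ 2 ≤ I := by
    refine ae_all_iff.2 fun n => ae_restrict_of_ae ?_
    exact (ae_restrict_iff' measurableSet_Ioo).1
      (ae_energy_ball_le_typeIBound (u := u) (p := p) (G := G) (r := (n : ℝ) + 1)
        (by positivity))
  filter_upwards [hall, hconst, ae_restrict_mem measurableSet_Iio] with t hallt hbt ht
  obtain ⟨b, hb⟩ := hbt
  have ht0 : t < 0 := ht
  -- it suffices that the constant vanishes
  suffices hb0 : b = 0 by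
    rw [hb0] at hb
    exact hb
  by_contra hb0
  set V : ℝ≥0∞ := volume (ball (0 : EuclideanSpace ℝ (Fin 3)) 1) with hV
  have hV0 : V ≠ 0 := (measure_ball_pos volume (0 : EuclideanSpace ℝ (Fin 3)) one_pos).ne'
  have hb_ne : ‖b‖ₑ ^ 2 ≠ 0 := pow_ne_zero 2 (enorm_ne_zero.2 hb0)
  set c : ℝ≥0∞ := ‖b‖ₑ ^ 2 * V with hc
  have hc0 : c ≠ 0 := mul_ne_zero hb_ne hV0
  -- the lower bound `c r² ≤ I` at every admissible radius `r = n + 1 > -t`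
  have key : ∀ n : ℕ, -t ≤ (n : ℝ) → c * ENNReal.ofReal (((n : ℝ) + 1) ^ 2) ≤ I := by
    intro n hn
    set r : ℝ := (n : ℝ) + 1 with hr
    have hrpos : 0 < r := by positivity
    have htmem : t ∈ Ioo (-r ^ 2) (0 : ℝ) := by
      refine ⟨?_, ht0⟩
      have h1 : (1 : ℝ) ≤ r := by
        have := (n.cast_nonneg : (0 : ℝ) ≤ n)
        linarith
      nlinarith
    have hinv : (ENNReal.ofReal r)⁻¹ * ENNReal.ofReal r = 1 :=
      ENNReal.inv_mul_cancel (ENNReal.ofReal_pos.2 hrpos).ne' ENNReal.ofReal_ne_top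
    calc c * ENNReal.ofReal (r ^ 2)
        = (ENNReal.ofReal r)⁻¹ * ENNReal.ofReal r * (‖b‖ₑ ^ 2 * V * ENNReal.ofReal (r ^ 2)) := by
          rw [hinv, one_mul]
      _ = (ENNReal.ofReal r)⁻¹ * (‖b‖ₑ ^ 2 * volume (ball (0 : EuclideanSpace ℝ (Fin 3)) r)) := by
          rw [volume_ball_eq_ofReal_pow_three_mul 0 hrpos,
            show r ^ 3 = r * r ^ 2 by ring, ENNReal.ofReal_mul hrpos.le]
          ring
      _ = (ENNReal.ofReal r)⁻¹ * ∫⁻ x in ball (0 : EuclideanSpace ℝ (Fin 3)) r, ‖u t x‖ₑ ^ 2 := by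
          rw [setLIntegral_enorm_sq_of_ae_eq_const hb]
      _ ≤ I := hallt n htmem
  -- hence `c * m ≤ I` for every `m : ℕ`, i.e. `c * ∞ ≤ I < ∞` with `c ≠ 0`: contradiction
  have hcn : ∀ m : ℕ, c * (m : ℝ≥0∞) ≤ I := by
    intro m
    set n : ℕ := max m ⌈-t⌉₊ with hn
    have hnt : -t ≤ (n : ℝ) :=
      (Nat.le_ceil (-t)).trans (by exact_mod_cast le_max_right m ⌈-t⌉₊)
    have h1 : (m : ℝ≥0∞) ≤ ENNReal.ofReal (((n : ℝ) + 1) ^ 2) := by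
      have hmn : (m : ℝ) ≤ n := by exact_mod_cast le_max_left m ⌈-t⌉₊
      rw [← ENNReal.ofReal_natCast m]
      exact ENNReal.ofReal_le_ofReal
        (by nlinarith [sq_nonneg (n : ℝ), (n.cast_nonneg : (0 : ℝ) ≤ n)])
    calc c * (m : ℝ≥0∞) ≤ c * ENNReal.ofReal (((n : ℝ) + 1) ^ 2) := by gcongr
      _ ≤ I := key n hnt
  have htop : c * ∞ ≤ I := by
    rw [← ENNReal.iSup_natCast, ENNReal.mul_iSup]
    exact iSup_le hcn
  rw [ENNReal.mul_top hc0] at htop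
  exact (lt_irrefl _) (htop.trans_lt hI)

/-- **A field with `𝐈 < ∞` which is not a.e. zero is not slice-wise a.e. constant**
(unconditional repackaging of `ae_slice_eq_zero_of_abTypeIBound` for fields jointly
a.e.-strongly measurable on the slab `(-∞, 0) × ℝ³`; Albritton–Barker 2019, §1: "`v ≡ const.`
and `𝐈 < ∞` imply `v ≡ 0`"). [cite: AlbrittonBarker2019, §1 after Thm 1.1] -/
theorem not_ae_slice_const_of_abTypeIBound
    (hjoint : AEStronglyMeasurable (uncurry u)
      (volume.restrict (Iio (0 : ℝ) ×ˢ (univ : Set (EuclideanSpace ℝ (Fin 3))))))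
    (hne : ¬ (uncurry u =ᵐ[volume.restrict
      (Iio (0 : ℝ) ×ˢ (univ : Set (EuclideanSpace ℝ (Fin 3))))] 0))
    (hI : typeIBound (Iio (0 : ℝ) ×ˢ (univ : Set (EuclideanSpace ℝ (Fin 3)))) u p G < ∞) :
    ¬ ∀ᵐ t ∂(volume.restrict (Iio (0 : ℝ))),
        ∃ b : EuclideanSpace ℝ (Fin 3), u t =ᵐ[volume] fun _ => b := by
  intro hconst
  refine hne ?_
  filter_upwards [ae_eq_zero_slab_of_ae_slice hjoint (ae_slice_eq_zero_of_abTypeIBound hI hconst)]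
    with z hz
  exact hz

/-- **(L) excludes Type I ancient solutions with measurable slices, space–time form, printed
`𝐈`** (Albritton–Barker 2019, §1: "If true, the conjecture excludes Type I singularities"; here
the elementary half "`v ≡ const.` and `𝐈 < ∞` imply `v ≡ 0`"): under `LiouvilleConjectureNS`,
a bounded ancient mild solution (`ν = 1`) with a.e.-strongly measurable slices, jointly
a.e.-strongly measurable on the slab `(-∞, 0) × ℝ³`, with `typeIBound (Iio 0 ×ˢ univ) u p G < ∞`,
is a.e. zero on the slab ((L) makes every slice a.e. constant; then
`ae_slice_eq_zero_of_abTypeIBound` and `ae_eq_zero_slab_of_ae_slice`).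
[cite: AlbrittonBarker2019, §1 after Thm 1.1] -/
theorem LiouvilleConjectureNS.ae_eq_zero_slab_of_abTypeIBound (hL : LiouvilleConjectureNS)
    (hu : FluidPDE.IsBoundedAncientMildSolution 1 u)
    (hmeas : ∀ t < 0, AEStronglyMeasurable (u t) volume)
    (hjoint : AEStronglyMeasurable (uncurry u)
      (volume.restrict (Iio (0 : ℝ) ×ˢ (univ : Set (EuclideanSpace ℝ (Fin 3))))))
    (hI : typeIBound (Iio (0 : ℝ) ×ˢ (univ : Set (EuclideanSpace ℝ (Fin 3)))) u p G < ∞) :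
    uncurry u =ᵐ[volume.restrict (Iio (0 : ℝ) ×ˢ (univ : Set (EuclideanSpace ℝ (Fin 3))))] 0 := by
  have hconst : ∀ᵐ t ∂(volume.restrict (Iio (0 : ℝ))),
      ∃ b : EuclideanSpace ℝ (Fin 3), u t =ᵐ[volume] fun _ => b := by
    filter_upwards [ae_restrict_mem measurableSet_Iio] with t ht
    exact hL u hu hmeas t ht
  filter_upwards [ae_eq_zero_slab_of_ae_slice hjoint (ae_slice_eq_zero_of_abTypeIBound hI hconst)]
    with z hz
  exact hz

/-- **Under (L), a witness of `NontrivialMildAncientTypeIExists` must have a non-measurable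
slice.** If `LiouvilleConjectureNS` holds and `(u, p, G)` satisfies the clauses of
`NontrivialMildAncientTypeIExists` that matter here — `u` is a bounded ancient mild solution
(`ν = 1`), `G` is a weak spatial gradient of `u` on the slab `(-∞, 0) × ℝ³` (whence `u` is
locally integrable, so jointly a.e.-strongly measurable, there), `u` is not a.e. zero on the
slab, and `𝐈 < ∞` — then some slice `u t`, `t < 0`, is not a.e.-strongly measurable
(Albritton–Barker 2019, §1; the measurability gap is that of the accepted duality-form class,
see the module docstring). [cite: AlbrittonBarker2019, §1 after Thm 1.1] -/
theorem LiouvilleConjectureNS.exists_not_aestronglyMeasurable_slice_of_abTypeIBound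
    (hL : LiouvilleConjectureNS) (hu : FluidPDE.IsBoundedAncientMildSolution 1 u)
    (hG : FluidPDE.HasWeakSpatialGradientOn
      (FluidPDE.slab (EuclideanSpace ℝ (Fin 3)) (Iio 0) isOpen_Iio) u G)
    (hne : ¬ (uncurry u =ᵐ[volume.restrict
      (Iio (0 : ℝ) ×ˢ (univ : Set (EuclideanSpace ℝ (Fin 3))))] 0))
    (hI : typeIBound (Iio (0 : ℝ) ×ˢ (univ : Set (EuclideanSpace ℝ (Fin 3)))) u p G < ∞) :
    ∃ t < 0, ¬ AEStronglyMeasurable (u t) volume := by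
  by_contra h
  have h' : ∀ t < 0, AEStronglyMeasurable (u t) volume := fun t ht => by
    by_contra hnt
    exact h ⟨t, ht, hnt⟩
  exact hne
    (hL.ae_eq_zero_slab_of_abTypeIBound hu h' hG.locallyIntegrableOn.aestronglyMeasurable hI)

/-- **(L) refutes `NontrivialMildAncientTypeIExists` up to slice measurability.** Under
`LiouvilleConjectureNS` there is no triple `(u, p, G)` satisfying the five clauses of
`Literature.Analysis.FluidPDE.NontrivialMildAncientTypeIExists` (mild bounded ancient solution,
suitable weak solution on `(-∞, 0) × ℝ³` with pressure `p`, weak spatial gradient `G`,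
non-triviality, `𝐈 = typeIBound (Iio 0 ×ˢ univ) u p G < ∞`) **and** having a.e.-strongly
measurable slices `u t` at every `t < 0` (Albritton–Barker 2019, §1: "If true, the conjecture
excludes Type I singularities" — the elementary half, constants being excluded by `𝐈 < ∞`).
The unconditional `LiouvilleConjectureNS → ¬ NontrivialMildAncientTypeIExists` is not claimed
(module docstring). [cite: AlbrittonBarker2019, §1 after Thm 1.1] -/
theorem LiouvilleConjectureNS.not_nontrivialMildAncientTypeIExists_measurable
    (hL : LiouvilleConjectureNS) :
    ¬ ∃ (u : ℝ → EuclideanSpace ℝ (Fin 3) → EuclideanSpace ℝ (Fin 3))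
        (p : ℝ → EuclideanSpace ℝ (Fin 3) → ℝ)
        (G : ℝ → EuclideanSpace ℝ (Fin 3) → EuclideanSpace ℝ (Fin 3) →L[ℝ] EuclideanSpace ℝ (Fin 3)),
      (∀ t < 0, AEStronglyMeasurable (u t) volume) ∧
      FluidPDE.IsBoundedAncientMildSolution 1 u ∧
      FluidPDE.IsSuitableWeakSolutionOn
        (FluidPDE.slab (EuclideanSpace ℝ (Fin 3)) (Iio 0) isOpen_Iio) 1 0 u p ∧
      FluidPDE.HasWeakSpatialGradientOn
        (FluidPDE.slab (EuclideanSpace ℝ (Fin 3)) (Iio 0) isOpen_Iio) u G ∧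
      ¬ (uncurry u =ᵐ[volume.restrict
        (Iio (0 : ℝ) ×ˢ (univ : Set (EuclideanSpace ℝ (Fin 3))))] 0) ∧
      typeIBound (Iio (0 : ℝ) ×ˢ (univ : Set (EuclideanSpace ℝ (Fin 3)))) u p G < ∞ := by
  rintro ⟨u, p, G, hmeas, hu, -, hG, hne, hI⟩
  obtain ⟨t, ht, hnot⟩ := hL.exists_not_aestronglyMeasurable_slice_of_abTypeIBound hu hG hne hI
  exact hnot (hmeas t ht)

/-- Sanity link with the registered open statement: dropping the measurability clause from the
statement refuted above gives back exactly `NontrivialMildAncientTypeIExists`; in particular a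
witness of `NontrivialMildAncientTypeIExists` with measurable slices would contradict (L)
(contrapositive packaging of `not_nontrivialMildAncientTypeIExists_measurable`).
[cite: AlbrittonBarker2019, §1 after Thm 1.1] -/
theorem not_liouvilleConjectureNS_of_nontrivialMildAncientTypeI_measurable
    (h : ∃ (u : ℝ → EuclideanSpace ℝ (Fin 3) → EuclideanSpace ℝ (Fin 3))
        (p : ℝ → EuclideanSpace ℝ (Fin 3) → ℝ)
        (G : ℝ → EuclideanSpace ℝ (Fin 3) → EuclideanSpace ℝ (Fin 3) →L[ℝ] EuclideanSpace ℝ (Fin 3)),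
      (∀ t < 0, AEStronglyMeasurable (u t) volume) ∧
      FluidPDE.IsBoundedAncientMildSolution 1 u ∧
      FluidPDE.IsSuitableWeakSolutionOn
        (FluidPDE.slab (EuclideanSpace ℝ (Fin 3)) (Iio 0) isOpen_Iio) 1 0 u p ∧
      FluidPDE.HasWeakSpatialGradientOn
        (FluidPDE.slab (EuclideanSpace ℝ (Fin 3)) (Iio 0) isOpen_Iio) u G ∧
      ¬ (uncurry u =ᵐ[volume.restrict
        (Iio (0 : ℝ) ×ˢ (univ : Set (EuclideanSpace ℝ (Fin 3))))] 0) ∧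
      typeIBound (Iio (0 : ℝ) ×ˢ (univ : Set (EuclideanSpace ℝ (Fin 3)))) u p G < ∞) :
    NontrivialMildAncientTypeIExists ∧ ¬ LiouvilleConjectureNS := by
  refine ⟨?_, fun hL => hL.not_nontrivialMildAncientTypeIExists_measurable h⟩
  obtain ⟨u, p, G, -, hu, hs, hG, hne, hI⟩ := h
  exact ⟨u, p, G, hu, hs, hG, hne, hI⟩

end LocalTypeILiouville

end Literature.Analysis.FluidPDE
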